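import Mathlib.Analysis.SpecialFunctions.Pow.Real
import Mathlib.Topology.MetricSpace.Isometry
import Summits.Ventures.Crystal3D.LocalLP.ContactBridge
import Summits.Ventures.Crystal3D.StickySpheres.Witnesses
import Summits.Ventures.Crystal3D.StickySpheres.LiteratureBridge
import Literature.Geometry.DiscreteGeometry.UnitDiscContactNumber
import Literature.MathematicalPhysics.StatisticalMechanics.BarlowStacking
import HarnessLib

/-!
# Venture `Crystal3D` — statements (Props) and their status links

HONEST FRAMING. This is the statement file of the venture `Summits/Ventures/Crystal3D` (cell
`pub-crystal3d`: exact rigid-cluster / contact-graph enumeration + linear programming over local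
inequalities, Hales/Flyspeck pattern, for sticky-sphere crystallization). It states the venture's
PROPOSITIONS over the landed substrate `StickySpheres/ContactGraph.lean` (`IsUnitPacking`,
`numContacts`, `maxContacts d N` = Bezdek's `C(N)` / Harborth's `B(n)`, contact distance `1`),
and next to each proposition records its STATUS in the tree by a proved link: KNOWN results are
tied to the Literature's named facts by one-line transfer theorems (so that nothing published is
restated as a second hypothesis), PROVED ones to their tree theorems; TARGET and OPEN ones carry
no link. NO three-dimensional crystallization theorem is claimed anywhere in this venture. Which
targets the cell attacks, with which constants, is fixed in the cell's `PLAN.md`.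

## The ladder

* 2D control: `HarborthFormula N` — `B(N) = ⌊3N - √(12N - 3)⌋` in the venture's vocabulary
  (`harborthNumber` is the Literature's, `UnitDiscContactNumber.lean`); `HarborthTheorem` (KNOWN =
  transfer of `Literature…Harborth1974_contactNumber`, `harborthTheorem_of_literature`);
  `HarborthUpTo N₀` (the finite re-derivation target of the 2D pipeline); `HeitmannRadinLattice`
  (KNOWN = transfer of `Literature…HeitmannRadin1980_groundStates`, `n ≥ 3` as printed).
* 3D leading term: `ContactsLeSixN` — PROVED (`contactsLeSixN_holds` = `maxContacts_three_le`,
  kissing number twelve).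
* 3D surface term: `SurfaceBound γ` (`C(x) < 6N - γ N^{2/3}` for every packing, `N ≥ 2`);
  `BezdekReidBound = SurfaceBound 0.926` (KNOWN = transfer of
  `Literature…BezdekReid2013_contactNumber_lt` through the venture's radius-one bridge,
  `bezdekReidBound_of_literature`); larger `γ` is the cell's census TARGET — the conditional
  headlines `H1_surfaceBound` (`γ = 23/10`) / `H2_surfaceBound` (`γ = 79/25`) of `LocalLP/` are
  instances of `SurfaceBound` under their named inputs (`surfaceBound_iff`).
* 3D construction side: `OctahedralLowerBound` (KNOWN, Bezdek 2012 Thm 1.1 (iii); instances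
  `k = 2, 3, 4` proved in `Literature…ContactNumberBounds.lean`), `SmallContactLowerBounds`
  (PROVED: `smallContactLowerBounds_holds`, kernel-checked integer models),
  `SmallContactUpperBounds` (TARGET of the enumeration lane; conditional versions in
  `StickySpheres/SmallContactTable.lean`).
* 3D asymptotics: `ContactsPerParticleTendstoSix` (TARGET, energetic form of sticky
  crystallization), `SurfaceConstantExists` (OPEN: Bezdek 2013 Problem 2). A POSITIONAL
  crystallization statement (Blanc–Lewin (16)–(17) for sticky ground states; `d = 3` OPEN, not
  claimed, false for small `N` by the tree barrier `StickySphereClusters`) is deliberately not in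
  this version; its threshold-form wording is drafted by the cell and audited before an append.

## Sources (bib keys in `references.bib`; locators as printed)

Harborth1974 ((5)–(6): `B(n) = [3n - √(12n-3)]`), HeitmannRadin1980 (Theorem (1), (2)(a),
p. 284), Bezdek2012 (DCG 48, Theorem 1.1 (i)–(iii)), BezdekReid2013 (J. Geom. 104, Theorem 1 (i):
`C(n) < 6n - 0.926 n^{2/3}`, `n ≥ 2`), Bezdek's survey §2.1 in Fields Inst. Commun. 69 (2013)
("C(9) = 21, C(10) = 25 [AMB] and C(11) = 29 [Hoy et al.]. However, the status of the
mathematical rigour … remains to be seen"; `C(12) ≥ 33`, `C(13) ≥ 36`; Problem 2),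
ArkusManoharanBrenner2011, HoyHarwayneGidanskyOHern2012, HolmesCerfon2016 (the enumerations),
BlancLewin2015 (§2.1 (15)–(17), §2.3).

## Design notes / wording risks

* Contact distance `1` (diameter-`1` balls) throughout; radius-`1` Literature statements enter
  through `StickySpheres/RadiusOne.lean` / `LiteratureBridge.lean`.
* `SurfaceBound γ` quantifies over packings (equivalently over `C(N)`, by
  `exists_numContacts_eq_maxContacts`); strict `<` and `N ≥ 2` exactly as printed; it is
  ANTITONE in `γ` (`SurfaceBound.anti`).
* `octahedralNumber k = k(2k²+1)/3` uses `ℕ`-division, which is exact (`3 ∣ k(2k²+1)`).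
* Real powers are `Real.rpow` of non-negative bases (no junk).
-/

noncomputable section

open scoped BigOperators Topology
open Filter

namespace Summit.Ventures.Crystal3D

open Literature.Geometry.DiscreteGeometry (harborthNumber contactPairCount IsMaximalDiscConfig
  Harborth1974_contactNumber HeitmannRadin1980_groundStates BezdekReid2013_contactNumber_lt)
open Literature.MathematicalPhysics.StatisticalMechanics (Theil2006.triPoint)

/-! ## Sticky ground states -/

/-- A **sticky ground state** of `N` hard sticky spheres in `ℝᵈ`: a unit packing with the maximal
number of contacts `C(N)` (energy `-C(N)`). -/
def IsStickyGroundState {d N : ℕ} (x : Fin N → EuclideanSpace ℝ (Fin d)) : Prop :=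
  IsUnitPacking x ∧ numContacts x = maxContacts d N

/-- The venture's contact count IS the Literature's `contactPairCount` (same expression). -/
theorem numContacts_eq_contactPairCount {d N : ℕ} (x : Fin N → EuclideanSpace ℝ (Fin d)) :
    numContacts x = contactPairCount x :=
  rfl

/-- In the plane, a sticky ground state is a maximal disc configuration in the sense of
Heitmann–Radin (`Literature…IsMaximalDiscConfig`). -/
theorem IsStickyGroundState.isMaximalDiscConfig {N : ℕ} {x : Fin N → EuclideanSpace ℝ (Fin 2)}
    (hx : IsStickyGroundState x) : IsMaximalDiscConfig x :=
  ⟨hx.1, fun y hy => by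
    rw [← numContacts_eq_contactPairCount, ← numContacts_eq_contactPairCount, hx.2]
    exact numContacts_le_maxContacts hy⟩

/-! ## Two dimensions (the pipeline's control case) -/

/-- **Harborth's formula at `N`** in the venture's vocabulary: the maximal contact number of `N`
unit discs is `⌊3N - √(12N - 3)⌋` (`harborthNumber`, from
`Literature/Geometry/DiscreteGeometry/UnitDiscContactNumber.lean`); equivalently the
Heitmann–Radin sticky-disc ground-state energy of `N` discs is `-⌊3N - √(12N - 3)⌋`. -/
def HarborthFormula (N : ℕ) : Prop :=
  (maxContacts 2 N : ℤ) = harborthNumber N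

/-- **Harborth 1974** (KNOWN): the formula for every `N`. This is the tree's named fact
`Literature.Geometry.DiscreteGeometry.Harborth1974_contactNumber` (Harborth1974 (5)–(6), =
Heitmann–Radin 1980 Theorem (1)) read in the venture's vocabulary — see
`harborthTheorem_of_literature`; it is NOT a second hypothesis. -/
def HarborthTheorem : Prop :=
  ∀ N : ℕ, HarborthFormula N

/-- **Transfer**: the Literature fact gives `HarborthTheorem` (bound on every packing +
attainment ⇒ the maximum equals Harborth's number). -/
theorem harborthTheorem_of_literature (h : Harborth1974_contactNumber) : HarborthTheorem := by
  intro N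
  obtain ⟨hle, y, hy, hyN⟩ := h N
  obtain ⟨x, hx, hxe⟩ := exists_numContacts_eq_maxContacts (d := 2) (by norm_num) N
  refine le_antisymm ?_ ?_
  · rw [← hxe]; exact hle x hx
  · rw [← hyN]; exact_mod_cast numContacts_le_maxContacts hy

/-- **STEP-0 target of the 2D pipeline**: Harborth's formula for all `2 ≤ N ≤ N₀`, to be
re-derived by exact enumeration + certificates (a consequence of `HarborthTheorem`, stated as the
finite check the pipeline reproduces). -/
def HarborthUpTo (N₀ : ℕ) : Prop :=
  ∀ N : ℕ, 2 ≤ N → N ≤ N₀ → HarborthFormula N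

/-- The known theorem implies every finite instance. -/
theorem harborthUpTo_of_harborthTheorem (h : HarborthTheorem) (N₀ : ℕ) : HarborthUpTo N₀ :=
  fun N _ _ => h N

/-- **Heitmann–Radin 1980, Theorem (2)(a), corollary form** (KNOWN; `n ≥ 3` as printed, p. 284):
every sticky-disc ground state of `N ≥ 3` discs lies on one congruent copy `A(A₂) + t` of the
triangular lattice (`A` a linear isometry, `t` a translation; `Theil2006.triPoint` labels `A₂`).
This is the tree's named fact `Literature…HeitmannRadin1980_groundStates` in the venture's
vocabulary — see `heitmannRadinLattice_of_literature`; the polygon clause of (2)(a) and (2)(b)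
are not transcribed (as in the Literature file). -/
def HeitmannRadinLattice : Prop :=
  ∀ N : ℕ, 3 ≤ N → ∀ x : Fin N → EuclideanSpace ℝ (Fin 2), IsStickyGroundState x →
    ∃ (A : EuclideanSpace ℝ (Fin 2) →ₗᵢ[ℝ] EuclideanSpace ℝ (Fin 2)) (t : EuclideanSpace ℝ (Fin 2)),
      ∀ i : Fin N, ∃ k : ℤ × ℤ, x i = A (Theil2006.triPoint k) + t

/-- **Transfer**: the Literature fact gives `HeitmannRadinLattice`. -/
theorem heitmannRadinLattice_of_literature (h : HeitmannRadin1980_groundStates) :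
    HeitmannRadinLattice :=
  fun N hN x hx => h N hN x hx.isMaximalDiscConfig

/-! ## Three dimensions: the contact-number ladder -/

/-- **Leading term** `C(N) ≤ 6N` for all `N` (PROVED: `contactsLeSixN_holds`). -/
def ContactsLeSixN : Prop :=
  ∀ N : ℕ, maxContacts 3 N ≤ 6 * N

/-- `ContactsLeSixN` holds (kissing number twelve; `LocalLP/ContactBridge.lean`). -/
theorem contactsLeSixN_holds : ContactsLeSixN :=
  maxContacts_three_le

/-- **Surface-corrected contact bound with constant `γ`**: every packing of `N ≥ 2` unit-diameter
balls in `ℝ³` has fewer than `6N - γ N^{2/3}` contacts. `γ = 0.926` is Bezdek–Reid (KNOWN); the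
cell's census TARGET is the largest `γ` its certified local inequalities + LP support
(necessarily `γ < ∛486 = 7.862…` by `OctahedralLowerBound`). -/
def SurfaceBound (γ : ℝ) : Prop :=
  ∀ N : ℕ, 2 ≤ N → ∀ x : Fin N → EuclideanSpace ℝ (Fin 3), IsUnitPacking x →
    (numContacts x : ℝ) < 6 * N - γ * (N : ℝ) ^ ((2 : ℝ) / 3)

/-- Unfolding lemma: the conditional headlines of `LocalLP/H1Instance.lean`,
`LocalLP/H2Instance.lean` conclude literally the right-hand side, hence `SurfaceBound (23/10)`,
`SurfaceBound (79/25)` under their named inputs. -/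
theorem surfaceBound_iff (γ : ℝ) :
    SurfaceBound γ ↔ ∀ N : ℕ, 2 ≤ N → ∀ x : Fin N → EuclideanSpace ℝ (Fin 3), IsUnitPacking x →
      (numContacts x : ℝ) < 6 * N - γ * (N : ℝ) ^ ((2 : ℝ) / 3) :=
  Iff.rfl

/-- A larger surface constant is a stronger statement: `SurfaceBound` is antitone in `γ`. -/
theorem SurfaceBound.anti {γ γ' : ℝ} (h : γ' ≤ γ) (hγ : SurfaceBound γ) : SurfaceBound γ' := by
  intro N hN x hx
  have h1 := hγ N hN x hx
  have h2 : γ' * (N : ℝ) ^ ((2 : ℝ) / 3) ≤ γ * (N : ℝ) ^ ((2 : ℝ) / 3) :=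
    mul_le_mul_of_nonneg_right h (Real.rpow_nonneg (Nat.cast_nonneg N) _)
  linarith

/-- **Bezdek–Reid 2013, Theorem 1 (i)** (KNOWN): `C(n) < 6n - 0.926 n^{2/3}` for all `n ≥ 2`,
i.e. `SurfaceBound 0.926`. This is the tree's named fact
`Literature…BezdekReid2013_contactNumber_lt` (radius-`1` form) transported by the venture's
scaling bridge — see `bezdekReidBound_of_literature`; the LP lane's STEP-0 reproduces the printed
constant from the printed local constants. -/
def BezdekReidBound : Prop :=
  SurfaceBound 0.926

/-- **Transfer**: the Literature fact gives `BezdekReidBound`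
(`StickySpheres/LiteratureBridge.lean`). -/
theorem bezdekReidBound_of_literature (h : BezdekReid2013_contactNumber_lt) : BezdekReidBound :=
  fun _ hN x hx => numContacts_lt_of_bezdekReid h hN x hx

/-- The **octahedral numbers** `k(2k²+1)/3 = 1, 6, 19, 44, 85, …` (balls in Bezdek's regular
octahedral pieces of the face-centred cubic lattice; `3 ∣ k(2k²+1)`, so `ℕ`-division is exact). -/
def octahedralNumber (k : ℕ) : ℕ :=
  k * (2 * k ^ 2 + 1) / 3

/-- **Bezdek 2012 (DCG 48), Theorem 1.1 (iii)** (KNOWN, construction side): for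
`N = k(2k²+1)/3`, `k ≥ 2`, `6N - ∛486 · N^{2/3} < C(N)`. Not vendored as a hypothesis-free
theorem; the instances `k = 2, 3, 4` are PROVED in
`Literature/Geometry/DiscreteGeometry/ContactNumberBounds.lean` (`bezdek2012_fcc_lower_bound_k2/3/4`,
with `le_maxContacts_fortyFour` for the transport at `k = 4`). -/
def OctahedralLowerBound : Prop :=
  ∀ k : ℕ, 2 ≤ k →
    6 * (octahedralNumber k : ℝ) -
        (486 : ℝ) ^ ((1 : ℝ) / 3) * (octahedralNumber k : ℝ) ^ ((2 : ℝ) / 3) <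
      maxContacts 3 (octahedralNumber k)

/-- **Small contact numbers, construction side** (PROVED, `smallContactLowerBounds_holds`):
`C(9) ≥ 21`, `C(10) ≥ 25`, `C(11) ≥ 29`, `C(12) ≥ 33` (two face-sharing octahedra + tetrahedral
caps, `StickySpheres/Witnesses.lean`) and `C(13) ≥ 36` (centred cuboctahedron,
`StickySpheres/RadiusOne.lean` from the tree's fcc nuclei) — Bezdek's survey §2.1 constructions. -/
def SmallContactLowerBounds : Prop :=
  21 ≤ maxContacts 3 9 ∧ 25 ≤ maxContacts 3 10 ∧ 29 ≤ maxContacts 3 11 ∧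
    33 ≤ maxContacts 3 12 ∧ 36 ≤ maxContacts 3 13

/-- `SmallContactLowerBounds` holds (kernel-checked integer models). -/
theorem smallContactLowerBounds_holds : SmallContactLowerBounds :=
  ⟨twentyOne_le_maxContacts_nine, twentyFive_le_maxContacts_ten, twentyNine_le_maxContacts_eleven,
    thirtyThree_le_maxContacts_twelve, thirtySix_le_maxContacts_thirteen⟩

/-- **Small contact numbers, enumeration side** (TARGET of the enumeration lane): `C(9) ≤ 21`,
`C(10) ≤ 25`, `C(11) ≤ 29` — printed as `C(9) = 21`, `C(10) = 25` (Arkus–Manoharan–Brenner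
2011) and `C(11) = 29` (Hoy–Harwayne-Gidansky–O'Hern 2012), with Bezdek's caveat "the status of
the mathematical rigour … remains to be seen" (no refereed proof of `C(n)` for any `n ≥ 6` is in
print; the tree has `C(6) = 12`). An upper bound needs COMPLETENESS of an enumeration — exactly
what a certified census establishes; the conditional forms are in
`StickySpheres/SmallContactTable.lean`. -/
def SmallContactUpperBounds : Prop :=
  maxContacts 3 9 ≤ 21 ∧ maxContacts 3 10 ≤ 25 ∧ maxContacts 3 11 ≤ 29

/-! ## Three dimensions: asymptotics -/

/-- **Contacts per particle tend to six** (TARGET; known in substance: `C(N) ≤ 6N` by the kissing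
number and `C(N) ≥ 6N - O(N^{2/3})` by fcc pieces): `C(N)/N → 6`, i.e. the sticky-sphere
ground-state energy per particle tends to `-6 = -(kissing number)/2` — the energetic form of
sticky crystallization in `ℝ³`. -/
def ContactsPerParticleTendstoSix : Prop :=
  Tendsto (fun N : ℕ => (maxContacts 3 N : ℝ) / N) atTop (𝓝 6)

/-- **The surface constant exists** (OPEN — Bezdek's survey 2013, Problem 2: "Does the limit
`lim_{n→∞} (6n - C(n))/n^{2/3}` exist?"). Recorded for orientation; NOT claimed. Known:
`0.926 < (6n - C(n))/n^{2/3} < 7.862…` along `n = k(2k²+1)/3`. -/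
def SurfaceConstantExists : Prop :=
  ∃ κ : ℝ, Tendsto (fun N : ℕ => (6 * (N : ℝ) - maxContacts 3 N) / (N : ℝ) ^ ((2 : ℝ) / 3))
    atTop (𝓝 κ)

/-! ## Positional sticky crystallization in `ℝ³` (OPEN; NOT claimed)

Appended after the referee's wording audit (cell file `ref/WORDING-AUDIT.md`, PASS): two
propositions typed only so that the paper's "what we do not claim" sentence has a formal referent.
Both are OPEN for `d = 3`; neither is asserted anywhere in the venture. The threshold form of the
first is forced by the tree barrier `StickySphereClusters` (the capped trigonal bipyramid is a
six-ball sticky ground state that is not a Barlow fragment; non-layered maximisers also occur at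
`N = 7, 8, 9`). In the second, rotations are NOT quotiented (only translations, as in Blanc–Lewin
(16)), which makes it formally stronger than "up to rigid motions"; the `tsum` over `P.points` is
an honest finite sum for compactly supported `f` (periodic configurations are locally finite). -/

/-- `x` is (congruent to) a **Barlow fragment**: some isometry of `ℝ³` carries every centre into
one Barlow stacking with touching spacings (`a = 1`, `h = √(2/3)`; tree
`Literature…barlowStacking`) and some Hägg word `σ`. -/
def IsBarlowFragment {N : ℕ} (x : Fin N → EuclideanSpace ℝ (Fin 3)) : Prop :=
  ∃ σ : ℤ → ℤ, Literature.MathematicalPhysics.StatisticalMechanics.IsHaggSeq σ ∧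
    ∃ g : EuclideanSpace ℝ (Fin 3) ≃ᵢ EuclideanSpace ℝ (Fin 3),
      ∀ i, g (x i) ∈ Literature.MathematicalPhysics.StatisticalMechanics.barlowStacking 1
        (Real.sqrt (2 / 3)) σ

/-- **Eventually-Barlow ground states** (OPEN, possibly false; NOT claimed; threshold form of
Bezdek's Problem 1): there is `N₀` such that every sticky ground state of `N ≥ N₀` balls in `ℝ³`
is a Barlow fragment. False without the threshold (`N = 6, …, 9`). -/
def EventuallyBarlowGroundStates : Prop :=
  ∃ N₀ : ℕ, ∀ N : ℕ, N₀ ≤ N → ∀ x : Fin N → EuclideanSpace ℝ (Fin 3),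
    IsStickyGroundState x → IsBarlowFragment x

/-- **Sticky crystallization in `ℝ³`, Blanc–Lewin form** (OPEN; NOT claimed): for every sequence
of sticky ground states `x^N` there are a subsequence `N_j`, translations `τ_j` and a periodic
configuration `P` of the tree (`PeriodicConfiguration 3`: full-rank lattice of periods, finite
non-empty motif) with `∑ᵢ f(xᵢ^{N_j} + τ_j) → ∑_{s ∈ P} f(s)` for every continuous compactly
supported `f` (multiplicity one: packings are `1`-separated). Blanc–Lewin 2015, §2.1 (15)–(17),
transcribed with "ground state" := maximal-contact unit packing. -/
def StickyCrystallizationBL : Prop :=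
  ∀ x : (N : ℕ) → (Fin N → EuclideanSpace ℝ (Fin 3)), (∀ N, IsStickyGroundState (x N)) →
    ∃ (φ : ℕ → ℕ) (τ : ℕ → EuclideanSpace ℝ (Fin 3))
      (P : Literature.MathematicalPhysics.StatisticalMechanics.PeriodicConfiguration 3),
      StrictMono φ ∧
      ∀ f : EuclideanSpace ℝ (Fin 3) → ℝ, Continuous f → HasCompactSupport f →
        Tendsto (fun j => ∑ i : Fin (φ j), f (x (φ j) i + τ j)) atTop
          (𝓝 (∑' s : P.points, f s))

end Summit.Ventures.Crystal3D

end
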